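/-
Copyright (c) 2026. All rights reserved.
Released under Apache 2.0 license as described in the file LICENSE.
Authors: abc-iut cell — seat abc-iut-L6-t15 (gen 3): proof-only companion to `HolomorphicCores`
([AbsTopIII] Prop 2.5), no new definitions.
-/
import Literature.AnabelianGeometry.AbsoluteAnabelian.ParallelogramsPlanarQuad

/-!
# Planar geometry behind [AbsTopIII] Prop 2.5, VII: opposite edges of a parallelogram are parallel

Proof-only companion (no definitions) to `HolomorphicCores.lean`, continuing `ParallelogramsPlanarQuad`.
For an open `U ⊆ ℂ`, `𝒮(U) ⊆ 𝒬 ⊆ 𝒫(U)` and a non-degenerate parallelogram `P = openParallelogram z v w`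
with `P̄ ⊆ U`, the opposite edges `[z, z+v]` and `[z+w, z+w+v]` are PARALLEL line segments of `(U, 𝒬)` in
the sense of Prop 2.5 (b): writing `w = a v + b (I v)`, the chords `C(t) = [z + t w, z + t w + v]` of `P̄`
at heights `t = k/N` are successively STRICTLY parallel — a small square with side vector `(b/N) v`, placed
with its bottom side on `C(k/N)`, has its top side on `C((k+1)/N)` and its closure inside a closed
thickening of `P̄` contained in `U`.

Refereed classical mathematics (S. Mochizuki, *Topics in absolute anabelian geometry III*, §2; kurims
pages); nothing here bears on the disputed parts of IUT.
-/

namespace Literature.AnabelianGeometry.AbsoluteAnabelian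

open _root_.Complex _root_.Set _root_.Topology _root_.Filter _root_.Metric

noncomputable section

/-- Decomposition of `w` in the real basis `(v, I v)`. (Auxiliary.) [cite: MochizukiAbsTopIII2015, Proposition 2.5 (proof) pp.55–57] -/
theorem eq_re_mul_add_im_mul {v : ℂ} (hv : v ≠ 0) (w : ℂ) :
    w = ((w / v).re : ℂ) * v + ((w / v).im : ℂ) * (I * v) := by
  have : w = (w / v) * v := by field_simp
  conv_lhs => rw [this, ← Complex.re_add_im (w / v)]
  ring

/-- A chord `[z + t w, z + t w + v]` (`t ∈ [0,1]`) of a parallelogram lies in its closure.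
(Auxiliary.) [cite: MochizukiAbsTopIII2015, Proposition 2.5 (proof) pp.55–57] -/
theorem chord_subset_closure {z v w : ℂ} (h : LinearIndependent ℝ ![v, w]) {t : ℝ} (ht : 0 ≤ t)
    (ht1 : t ≤ 1) :
    segment ℝ (z + (t : ℂ) * w) (z + (t : ℂ) * w + v) ⊆ closure (openParallelogram z v w) := by
  refine (convex_closure_openParallelogram z v w).segment_subset ?_ ?_
  · exact (mem_closure_openParallelogram_iff h).2 ⟨0, t, le_rfl, zero_le_one, ht, ht1, by push_cast; ring⟩
  · exact (mem_closure_openParallelogram_iff h).2 ⟨1, t, zero_le_one, le_rfl, ht, ht1, by push_cast; ring⟩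

/-- **Prop 2.5 (b)**, the square-chain construction: for `P = openParallelogram z v w` non-degenerate with
`P̄ ⊆ U` (`U` open) and `𝒮(U) ⊆ 𝒬 ⊆ 𝒫(U)`, two chords of `P̄` at heights `t < t'` close enough are
STRICTLY PARALLEL line segments of `(U, 𝒬)`: a square of `𝒮(U)` has non-intersecting sides on them.
[cite: MochizukiAbsTopIII2015, Proposition 2.5 (b) p.56] -/
theorem Parallelograms.strictlyParallel_chords {U : Set ℂ} (hU : IsOpen U) {𝒬 : Set (Set U)}
    (h𝒬 : ∀ Q ∈ 𝒬, Subtype.val '' Q ∈ parallelogramsIn U)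
    (h𝒮 : ∀ Q : Set U, Subtype.val '' Q ∈ squaresIn U → Q ∈ 𝒬) {z v w : ℂ}
    (h : LinearIndependent ℝ ![v, w]) {ε : ℝ} (hthick : cthickening ε (closure (openParallelogram z v w)) ⊆ U)
    {t δ : ℝ} (ht : 0 ≤ t) (htδ : t + δ ≤ 1) (hδ : 0 < δ)
    (hδa : δ * |(w / v).re| ≤ 4⁻¹) (hδb : δ * |(w / v).im| ≤ 4⁻¹) (hδε : δ * |(w / v).im| * ‖v‖ ≤ ε) :
    Parallelograms.StrictlyParallel 𝒬
      (Subtype.val ⁻¹' segment ℝ (z + (t : ℂ) * w) (z + (t : ℂ) * w + v))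
      (Subtype.val ⁻¹' segment ℝ (z + ((t + δ : ℝ) : ℂ) * w) (z + ((t + δ : ℝ) : ℂ) * w + v)) := by
  have hv : v ≠ 0 := by simpa using h.ne_zero 0
  set a : ℝ := (w / v).re with ha
  set b : ℝ := (w / v).im with hb
  have hwv : w = (a : ℂ) * v + (b : ℂ) * (I * v) := eq_re_mul_add_im_mul hv w
  have hb0 : b ≠ 0 := by
    intro hb0
    rw [hb0, Complex.ofReal_zero, zero_mul, add_zero] at hwv
    have := (LinearIndependent.pair_iff.1 h) a (-1) (by
      rw [Complex.real_smul, Complex.real_smul, hwv]; push_cast; ring)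
    norm_num at this
  have hKU : closure (openParallelogram z v w) ⊆ U := (self_subset_cthickening _).trans hthick
  -- the square
  set u : ℂ := ((δ * b : ℝ) : ℂ) * v with hu
  have hu0 : u ≠ 0 := mul_ne_zero (by exact_mod_cast mul_ne_zero hδ.ne' hb0) hv
  set q : ℂ := z + (t : ℂ) * w + ((2⁻¹ : ℝ) : ℂ) * v with hq
  have hli := linearIndependent_pair_mul_I hu0
  obtain ⟨A, hA⟩ := exists_homeomorph_frame q u (I * u) hli
  have habs_a : |δ * a| ≤ 4⁻¹ := by rwa [abs_mul, abs_of_pos hδ]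
  have habs_b : |δ * b| ≤ 4⁻¹ := by rwa [abs_mul, abs_of_pos hδ]
  -- points `q + s u` lie on the chord at height `t`
  have hbot : ∀ s : ℝ, 0 ≤ s → s ≤ 1 →
      q + (s : ℂ) * u ∈ segment ℝ (z + (t : ℂ) * w) (z + (t : ℂ) * w + v) := by
    intro s hs hs1
    have h1 := (abs_le.1 habs_b)
    refine mem_segment_of_eq_add_mul (μ := 2⁻¹ + s * (δ * b)) (by nlinarith) (by nlinarith) ?_
    rw [hq, hu]; push_cast; ring
  -- points `q + I u + s u` lie on the chord at height `t + δ`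
  have htop : ∀ s : ℝ, 0 ≤ s → s ≤ 1 →
      q + I * u + (s : ℂ) * u ∈
        segment ℝ (z + ((t + δ : ℝ) : ℂ) * w) (z + ((t + δ : ℝ) : ℂ) * w + v) := by
    intro s hs hs1
    have h1 := (abs_le.1 habs_b)
    have h2 := (abs_le.1 habs_a)
    refine mem_segment_of_eq_add_mul (μ := 2⁻¹ - δ * a + s * (δ * b)) (by nlinarith) (by nlinarith) ?_
    rw [hq, hu, hwv]; push_cast; ring
  have hcl : closure (openParallelogram q u (I * u)) ⊆ U := by
    intro x hx
    rw [mem_closure_openParallelogram_iff hli] at hx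
    obtain ⟨s, r, hs, hs1, hr, hr1, rfl⟩ := hx
    apply hthick
    refine Metric.mem_cthickening_of_dist_le _ (q + (s : ℂ) * u) ε _
      (chord_subset_closure h ht (by linarith) (hbot s hs hs1)) ?_
    rw [dist_eq_norm, show q + (s : ℂ) * u + (r : ℂ) * (I * u) - (q + (s : ℂ) * u) = (r : ℂ) * (I * u) by ring,
      norm_mul, norm_mul, Complex.norm_I, one_mul, Complex.norm_real, Real.norm_of_nonneg hr, hu,
      norm_mul, Complex.norm_real, Real.norm_eq_abs]
    calc r * (|δ * b| * ‖v‖) ≤ 1 * (|δ * b| * ‖v‖) := by gcongr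
      _ = δ * |b| * ‖v‖ := by rw [one_mul, abs_mul, abs_of_pos hδ]
      _ ≤ ε := hδε
  have hQU : openParallelogram q u (I * u) ⊆ U := subset_closure.trans hcl
  have himQ : Subtype.val '' (Subtype.val ⁻¹' openParallelogram q u (I * u) : Set U) =
      openParallelogram q u (I * u) := by
    rw [image_preimage_eq_inter_range, Subtype.range_coe, inter_eq_left.2 hQU]
  have hQ : (Subtype.val ⁻¹' openParallelogram q u (I * u) : Set U) ∈ 𝒬 :=
    h𝒮 _ ⟨q, u, hu0, himQ, himQ.symm ▸ hcl⟩
  -- its bottom and top sides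
  have hS := (Parallelograms.isSide_iff_of_subset hU h𝒬 h𝒮 hQ himQ hli hcl hA).2 ⟨_, Or.inl rfl, rfl⟩
  have hS' := (Parallelograms.isSide_iff_of_subset hU h𝒬 h𝒮 hQ himQ hli hcl hA).2
    ⟨_, Or.inr (Or.inl rfl), rfl⟩
  have hbotE : A '' (Icc 0 1 ×ℂ {(0 : ℝ)}) = segment ℝ q (q + u) := by
    rw [image_frame_Icc_const hA]; simp
  have htopE : A '' (Icc 0 1 ×ℂ {(1 : ℝ)}) = segment ℝ (q + I * u) (q + I * u + u) := by
    rw [image_frame_Icc_const hA]; simp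
  refine ⟨_, hQ, _, _, hS, hS', ?_, ?_, ?_⟩
  · rw [← preimage_inter, ← image_inter A.injective, reProdIm_inter_reProdIm]
    have : (Icc (0 : ℝ) 1 ∩ Icc 0 1) ×ℂ ({(0 : ℝ)} ∩ {1}) = ∅ := by
      ext p; simp [mem_reProdIm]
    rw [this, image_empty, preimage_empty]
  · rw [hbotE]
    refine preimage_mono ((convex_segment _ _).segment_subset ?_ ?_)
    · simpa using hbot 0 le_rfl zero_le_one
    · simpa using hbot 1 zero_le_one le_rfl
  · rw [htopE]
    refine preimage_mono ((convex_segment _ _).segment_subset ?_ ?_)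
    · simpa using htop 0 le_rfl zero_le_one
    · simpa using htop 1 zero_le_one le_rfl

/-- **Prop 2.5 (b)/(c)**: the opposite edges `[z, z+v]` and `[z+w, z+w+v]` of a non-degenerate parallelogram
`P = openParallelogram z v w` with `P̄ ⊆ U` are PARALLEL line segments of `(U, 𝒬)` (`𝒮(U) ⊆ 𝒬 ⊆ 𝒫(U)`):
chain the chords at heights `k/N` by `strictlyParallel_chords`.
[cite: MochizukiAbsTopIII2015, Proposition 2.5 (b) p.56] -/
theorem Parallelograms.parallel_opposite_edges {U : Set ℂ} (hU : IsOpen U) {𝒬 : Set (Set U)}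
    (h𝒬 : ∀ Q ∈ 𝒬, Subtype.val '' Q ∈ parallelogramsIn U)
    (h𝒮 : ∀ Q : Set U, Subtype.val '' Q ∈ squaresIn U → Q ∈ 𝒬) {z v w : ℂ}
    (h : LinearIndependent ℝ ![v, w]) (hKU : closure (openParallelogram z v w) ⊆ U) :
    Parallelograms.Parallel 𝒬 (Subtype.val ⁻¹' segment ℝ z (z + v))
      (Subtype.val ⁻¹' segment ℝ (z + w) (z + w + v)) := by
  have hv : v ≠ 0 := by simpa using h.ne_zero 0
  obtain ⟨ε, hε, hthick⟩ :=
    (isCompact_closure_openParallelogram h).exists_cthickening_subset_open hU hKU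
  set a : ℝ := |(w / v).re| with ha
  set b : ℝ := |(w / v).im| with hb
  have ha0 : 0 ≤ a := abs_nonneg _
  have hb0 : 0 ≤ b := abs_nonneg _
  -- the number of steps
  obtain ⟨N, hN1, hNa, hNb, hNε⟩ : ∃ N : ℕ, 1 ≤ N ∧ 4 * a ≤ N ∧ 4 * b ≤ N ∧ b * ‖v‖ ≤ N * ε := by
    refine ⟨⌈4 * a + 4 * b + b * ‖v‖ / ε⌉₊ + 1, by omega, ?_, ?_, ?_⟩
    · have h1 := Nat.le_ceil (4 * a + 4 * b + b * ‖v‖ / ε)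
      push_cast
      nlinarith [div_nonneg (mul_nonneg hb0 (norm_nonneg v)) hε.le]
    · have h1 := Nat.le_ceil (4 * a + 4 * b + b * ‖v‖ / ε)
      push_cast
      nlinarith [div_nonneg (mul_nonneg hb0 (norm_nonneg v)) hε.le]
    · have h1 := Nat.le_ceil (4 * a + 4 * b + b * ‖v‖ / ε)
      have h2 : b * ‖v‖ / ε ≤ (⌈4 * a + 4 * b + b * ‖v‖ / ε⌉₊ + 1 : ℕ) := by
        push_cast; nlinarith
      rwa [div_le_iff₀ hε] at h2
  have hNpos : (0 : ℝ) < N := by exact_mod_cast hN1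
  set δ : ℝ := (N : ℝ)⁻¹ with hδ
  have hδpos : 0 < δ := by positivity
  have hδN : (N : ℝ) * δ = 1 := by rw [hδ]; field_simp
  have hδa : δ * |(w / v).re| ≤ 4⁻¹ := by
    rw [← ha, hδ, inv_mul_le_iff₀ hNpos]; linarith
  have hδb : δ * |(w / v).im| ≤ 4⁻¹ := by
    rw [← hb, hδ, inv_mul_le_iff₀ hNpos]; linarith
  have hδε : δ * |(w / v).im| * ‖v‖ ≤ ε := by
    rw [← hb, hδ, mul_assoc, inv_mul_le_iff₀ hNpos]; exact hNε
  -- chords are line segments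
  have hls : ∀ t : ℝ, 0 ≤ t → t ≤ 1 → Parallelograms.IsLineSegment 𝒬
      (Subtype.val ⁻¹' segment ℝ (z + (t : ℂ) * w) (z + (t : ℂ) * w + v)) := fun t ht ht1 =>
    Parallelograms.isLineSegment_of_segment_subset hU h𝒬 h𝒮 (by simpa using hv)
      ((chord_subset_closure h ht ht1).trans hKU)
  have hkδ : ∀ k : ℕ, k ≤ N → (k : ℝ) * δ ≤ 1 := fun k hk => by
    rw [hδ, ← div_eq_mul_inv, div_le_one hNpos]; exact_mod_cast hk
  -- the chain
  have chain : ∀ k : ℕ, k ≤ N → Relation.EqvGen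
      (fun M M' : Set U => Parallelograms.IsLineSegment 𝒬 M ∧ Parallelograms.IsLineSegment 𝒬 M' ∧
        (M ⊆ M' ∨ Parallelograms.StrictlyParallel 𝒬 M M'))
      (Subtype.val ⁻¹' segment ℝ z (z + v))
      (Subtype.val ⁻¹' segment ℝ (z + (((k : ℝ) * δ : ℝ) : ℂ) * w) (z + (((k : ℝ) * δ : ℝ) : ℂ) * w + v)) := by
    intro k hk
    induction k with
    | zero => simp only [Nat.cast_zero, zero_mul, Complex.ofReal_zero, add_zero]; exact Relation.EqvGen.refl _
    | succ k ih =>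
      refine Relation.EqvGen.trans _ _ _ (ih (Nat.le_of_succ_le hk)) (Relation.EqvGen.rel _ _ ⟨?_, ?_, Or.inr ?_⟩)
      · exact hls _ (by positivity) (hkδ k (Nat.le_of_succ_le hk))
      · exact hls _ (by positivity) (hkδ (k + 1) hk)
      · have e : ((k : ℝ) * δ + δ) = (((k + 1 : ℕ) : ℝ) * δ) := by push_cast; ring
        have hst := Parallelograms.strictlyParallel_chords hU h𝒬 h𝒮 h hthick (t := (k : ℝ) * δ) (δ := δ)
          (z := z) (by positivity) (by rw [e]; exact hkδ (k + 1) hk) hδpos hδa hδb hδε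
        rwa [e] at hst
  have hfinal := chain N le_rfl
  rw [hδN] at hfinal
  simp only [Complex.ofReal_one, one_mul] at hfinal
  refine ⟨?_, ?_, hfinal⟩
  · simpa using hls 0 le_rfl zero_le_one
  · simpa using hls 1 zero_le_one le_rfl

/-- `openParallelogram` is symmetric in its two edge vectors.
(Auxiliary.) [cite: MochizukiAbsTopIII2015, Proposition 2.5 (proof) pp.55–57] -/
theorem openParallelogram_comm (z v w : ℂ) : openParallelogram z w v = openParallelogram z v w := by
  ext x
  simp only [openParallelogram, mem_setOf_eq]
  constructor
  · rintro ⟨s, t, hs, hs', ht, ht', rfl⟩; exact ⟨t, s, ht, ht', hs, hs', by ring⟩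
  · rintro ⟨s, t, hs, hs', ht, ht', rfl⟩; exact ⟨t, s, ht, ht', hs, hs', by ring⟩

/-- **Prop 2.5 (b)/(c)**: the other pair of opposite edges, `[z, z+w]` and `[z+v, z+v+w]`, are parallel line
segments of `(U, 𝒬)` as well. [cite: MochizukiAbsTopIII2015, Proposition 2.5 (b) p.56] -/
theorem Parallelograms.parallel_opposite_edges' {U : Set ℂ} (hU : IsOpen U) {𝒬 : Set (Set U)}
    (h𝒬 : ∀ Q ∈ 𝒬, Subtype.val '' Q ∈ parallelogramsIn U)
    (h𝒮 : ∀ Q : Set U, Subtype.val '' Q ∈ squaresIn U → Q ∈ 𝒬) {z v w : ℂ}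
    (h : LinearIndependent ℝ ![v, w]) (hKU : closure (openParallelogram z v w) ⊆ U) :
    Parallelograms.Parallel 𝒬 (Subtype.val ⁻¹' segment ℝ z (z + w))
      (Subtype.val ⁻¹' segment ℝ (z + v) (z + v + w)) :=
  Parallelograms.parallel_opposite_edges hU h𝒬 h𝒮 (LinearIndependent.pair_symm_iff.mp h)
    (by rwa [openParallelogram_comm])

end

end Literature.AnabelianGeometry.AbsoluteAnabelian
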